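import Summits.QuantumFields.BalabanUV.Beta.FP.ConstrainedBiLaplacianResponseTwoLevelEstimate
import Summits.QuantumFields.BalabanUV.Beta.FP.ConstrainedBiLaplacianSbCellMajorant
import Summits.QuantumFields.BalabanUV.Beta.FP.BiLaplaceResponseIsMultiplier

/-!
# `BalabanUV.Beta.FP.ConstrainedBiLaplacianResponseTwoLevelRate` — road «FP» for binder row D1, DESIGN ROW **GHOST-STEP** brick (g3) «(CONV-C)-Hb»,
# THE CONVERGENCE HALF, FILE 6d — THE ONE-STEP LAW OF THE BLOCK-SUM RESPONSE IN an2's OBJECTS: for EVERY `n, L ≥ 1`, every level-`n` cell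
# `τ` of a block `X` and every source block `y`,
# `|Σ_ρ Hb_{nL}((nL)•X + Tsub τ ρ, y) − Hb_n(n•X + τ, y)| ≤ ((n:ℝ)^{d+1})⁻¹·Cb(d+1,L)·HF(n)·n^{−2}·e^{−kappaB (d+1) 2·|X − y|_∞}`
# (the finer response SUMMED over the `L^{d+1}` finer points of the cell against the coarser response at the cell; `HF(n) ≤ (48(1+log n))^{d+1}`)

NOT IN PRINT; OUR PROOF ATTEMPT (binder row G-an2-4 ∕ (CONV-C), prover part P3 = fibre∕strip «Woodbury» lineage, gen 28; CRUX TEAM (2),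
2026-08-21).  HONEST DEPENDENCY (cell records, verbatim): «continuum YM on T⁴ ⇐ BetaPertH ∧ nine spine estimates (0/9 proved); BetaPertH ⇐ (D1) ∧
(D4) ∧ CAP+tail; G-an2-4 gates asym, D1 and NE2/3/4.»  HONEST FRAMING (cell contract, verbatim): «discharging `BetaPertH` makes Bałaban's UV
stability UNCONDITIONAL — a real constructive-QFT result; it is NOT the continuum limit and NOT the Clay problem.»  ABSOLUTE RULE (cell charter,
verbatim): «No internally-minted statement may enter as a cited fact. Every hypothesis is either kernel-proved in this package or a verbatim quotation
of a PUBLISHED theorem with page reference. The manuscript(s) under audit are NOT citable for their own disputed steps — they are the thing under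
adjudication; programme-internal (2001/route/tribunal) claims are never citable.»  THIS MODULE is [folklore] bookkeeping over FILES 3, 4b, 5c, 6a–6c of this
programme, `B4ContourShift.latticeKernel_decay`, `B4Green242Bridge.latticeKernel_sub` and d1-p3's `BiLaplaceResponseIsMultiplier.Wb_eq_neg_Hb`; it cites nothing as a hypothesis, has ONE bookkeeping `def`
(`Dsym`, the difference symbol), no `def … : Prop`, no `sorry`.

## Contents (dimension `d+1`; order `2`)

* `Dsym n L τ := Σ_ρ hM (n·L) 2 (Tsub τ ρ) − hM n 2 τ`, `Dsym_tr_side`, `differentiableAt_Dsym`, **`stripRegular_Dsym`** (bound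
  `((n:ℝ)^{d+1})⁻¹·(Cb (d+1) L·HF n (d+1))∕n²`, FILE 6c), `latticeKernel_Dsym` (the kernel of the difference is the difference of the kernels),
  **`two_level_kernel_rate`**: `‖Σ_ρ latticeKernel (hM (n·L) 2 (Tsub τ ρ)) x − latticeKernel (hM n 2 τ) x‖ ≤ ((n:ℝ)^{d+1})⁻¹·(Cb·HF∕n²)·e^{−kappaB|x|_∞}`.
* **`Hb_two_level_rate`** (through FILE 4b's junction `Hb_eq_re_KH`): the displayed one-step law for d1-p3's `BiLaplaceBlockResponse.Hb`; and the
  block-mean form **`Hb_two_level_rate_scaled`**: `|(n^{d+1})·(Σ_ρ Hb_{nL}(…) − Hb_n(…))| ≤ Cb (d+1) L·(48(1+log n))^{d+1}∕n²·e^{−kappaB|X−y|_∞}` —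
  the CONVERGENCE half of Q-FP-13-2 for the response (and, by d1-p3's `Hb = −Wbᵀ`, for an2's multiplier `Wb`): along `n_j = n₀·L^j` the one-step
  differences are summable (`j^{d+1}·L^{−2j}`), so the block-mean response tower is Cauchy entrywise with the FILE-4b majorant; and the same law
  for an2's multiplier kernel in the source variable, **`Wb_two_level_rate`** (through d1-p3's `BiLaplaceResponseIsMultiplier.Wb_eq_neg_Hb`).

NOT HERE (honest): the same for the compressed inverse `Sb` with BOTH legs cell-averaged (FILE 1's `avgM`; the two-leg core estimate is the analogue of
FILES 6b–6c with `Gfib` in place of `bvec`); the telescoped `∃ limit` packaging (routine from the one-step law, cf. the lineage's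
`SubAveragingUnitTower`).  0∕4 row-D1 binders touched.  NOT (CONV-C), NEVER «G-an2-4 closed», NOT the ghost step law, NOT SDF, NOT D1, NOT BetaPertH,
NOT continuum, NOT Clay.  Provenance: prover-b2b-balaban-gan24-p3-g28-0 (unit `b2b-balaban-gan24-p3`, gen 28), 2026-08-21; no existing file touched.
-/

noncomputable section

namespace Summit.QuantumFields.BalabanUV.Beta.FP.ConstrainedBiLaplacianResponseTwoLevelRate

open Complex Finset ComplexConjugate MeasureTheory
open Literature.MathematicalPhysics.QuantumFieldTheory
open Literature.MathematicalPhysics.QuantumFieldTheory.Balaban1983to89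
open Literature.MathematicalPhysics.QuantumFieldTheory.Balaban1983to89.B4Strip
open Literature.MathematicalPhysics.QuantumFieldTheory.Balaban1983to89.B4StripCauchy
open Literature.MathematicalPhysics.QuantumFieldTheory.Balaban1983to89.B5Strip145Analytic
open Literature.MathematicalPhysics.QuantumFieldTheory.Balaban1983to89.B5Strip145Decay
open Literature.MathematicalPhysics.QuantumFieldTheory.Balaban1983to89.B4StripSums
open Literature.MathematicalPhysics.QuantumFieldTheory.Balaban1983to89.B4ContourShift
open Literature.MathematicalPhysics.QuantumFieldTheory.Balaban1983to89.B4Green244 (coarse offset finePt coarse_finePt integrableOn_of_differentiableAt)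
open Literature.MathematicalPhysics.QuantumFieldTheory.Balaban1983to89.B4Green242Bridge (latticeKernel_sub)
open Summit.QuantumFields.BalabanUV.Beta.FP.ConstrainedBiLaplacianStrip
open Summit.QuantumFields.BalabanUV.Beta.FP.ConstrainedBiLaplacianKernel
open Summit.QuantumFields.BalabanUV.Beta.FP.ConstrainedBiLaplacianFibreIdentities
open Summit.QuantumFields.BalabanUV.Beta.FP.ConstrainedBiLaplacianResponse
open Summit.QuantumFields.BalabanUV.Beta.FP.ConstrainedBiLaplacianResponseFull (KH ofRealVec_mem_strip)
open Summit.QuantumFields.BalabanUV.Beta.FP.ConstrainedBiLaplacianResponseJunction (Hb_eq_re_KH)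
open Summit.QuantumFields.BalabanUV.Beta.FP.ConstrainedBiLaplacianSbCellMajorant (offset_finePt)
open Summit.QuantumFields.BalabanUV.Beta.FP.ConstrainedBiLaplacianResponseTwoLevel
open Summit.QuantumFields.BalabanUV.Beta.FP.ConstrainedBiLaplacianResponseTwoLevelSymbols
open Summit.QuantumFields.BalabanUV.Beta.FP.ConstrainedBiLaplacianResponseTwoLevelEstimate
open Summit.QuantumFields.BalabanUV.Beta.GAN24.SubAveragingKernel (Tsub HF HF_nonneg HF_le_log)
open Summit.QuantumFields.BalabanUV.Beta.FP.BiLaplaceBlockResponse (Hb)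
open Summit.QuantumFields.BalabanUV.Beta.FP.BiLaplaceResponseIsMultiplier (Wb_eq_neg_Hb)
open Literature.MathematicalPhysics.QuantumFieldTheory.Balaban1983to89.Beta.BiLaplaceBlockKKT (Wb)
open scoped Real

variable {d : ℕ}

/-! ## §1 The difference symbol and its strip regularity -/

/-- [folklore] **THE DIFFERENCE SYMBOL** of the one-step law: `Dsym n L τ p = Σ_ρ hM (n·L) 2 (Tsub τ ρ) p − hM n 2 τ p`. -/
def Dsym (n L : ℕ) [NeZero n] [NeZero L] (τ : Fin d → Fin n) (p : Fin d → ℂ) : ℂ :=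
  ∑ ρ : Fin d → Fin L, hM (n * L) 2 (Tsub n L τ ρ) p - hM n 2 τ p

/-- [folklore] Holomorphy of the difference symbol on the strip. -/
theorem differentiableAt_Dsym (n L : ℕ) [NeZero n] [NeZero L] (τ : Fin d → Fin n) {p : Fin d → ℂ} (hp : p ∈ Strip d (kappaB d 2)) :
    DifferentiableAt ℂ (Dsym n L τ) p := by
  show DifferentiableAt ℂ (fun q => ∑ ρ : Fin d → Fin L, hM (n * L) 2 (Tsub n L τ ρ) q - hM n 2 τ q) p
  refine DifferentiableAt.sub ?_ (differentiableAt_hM n 2 τ hp)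
  apply DifferentiableAt.fun_sum; intro ρ _
  exact differentiableAt_hM (n * L) 2 (Tsub n L τ ρ) hp

/-- [folklore] Side periodicity of the difference symbol (termwise `hM_tr_side`). -/
theorem Dsym_tr_side (n L : ℕ) [NeZero n] [NeZero L] {κ : ℝ} (hκ0 : 0 ≤ κ) (hκ : κ ≤ kappaB d 2) {p : Fin d → ℂ} (hp : p ∈ Strip d κ)
    (μ : Fin d) (hre : (p μ).re = -Real.pi) (τ : Fin d → Fin n) : Dsym n L τ (tr p μ) = Dsym n L τ p := by
  unfold Dsym
  rw [hM_tr_side n 2 hκ0 hκ hp μ hre]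
  congr 1
  exact Finset.sum_congr rfl fun ρ _ => hM_tr_side (n * L) 2 hκ0 hκ hp μ hre _

/-- [folklore] **STRIP REGULARITY OF THE DIFFERENCE SYMBOL** with the bound `((n:ℝ)^{d+1})⁻¹·(Cb (d+1) L·HF n (d+1))∕n²` (FILE 6c). -/
theorem stripRegular_Dsym (n L : ℕ) [NeZero n] [NeZero L] (τ : Fin (d + 1) → Fin n) :
    StripRegular (d := d) (Dsym n L τ) (kappaB (d + 1) 2) (((n : ℝ) ^ (d + 1))⁻¹ * (Cb (d + 1) L * HF n (d + 1) / (n : ℝ) ^ 2)) := by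
  have hκ0 : 0 ≤ kappaB (d + 1) 2 := (kappaB_pos (d + 1) 2).le
  have hdiffAt : ∀ p ∈ Strip (d + 1) (kappaB (d + 1) 2), DifferentiableAt ℂ (Dsym n L τ) p := fun p hp => differentiableAt_Dsym n L τ hp
  refine ⟨?_, ?_, ?_, ?_⟩
  · exact fun p hp => (hdiffAt p hp).continuousAt.continuousWithinAt
  · intro i q hq z hz
    have hP : i.insertNth z (ofRealVec q) ∈ Strip (d + 1) (kappaB (d + 1) 2) :=
      insertNth_mem_Strip hκ0 i hq (openRect_subset_closedRect _ hz)
    exact ((hdiffAt _ hP).comp z (differentiableAt_insertNth i _ z)).differentiableWithinAt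
  · intro i q hq y hy
    obtain ⟨hP, hre⟩ := insertNth_left_mem hκ0 i hq hy
    rw [← tr_insertNth_left]
    exact (Dsym_tr_side n L hκ0 le_rfl hP i hre τ).symm
  · intro p hp
    exact norm_sum_hM_Tsub_sub_hM_le n L hp τ

/-- [folklore] The kernel of the difference symbol is the difference of the kernels. -/
theorem latticeKernel_Dsym (n L : ℕ) [NeZero n] [NeZero L] (τ : Fin (d + 1) → Fin n) (x : Fin (d + 1) → ℤ) :
    latticeKernel (Dsym n L τ) x = ∑ ρ : Fin (d + 1) → Fin L, latticeKernel (hM (n * L) 2 (Tsub n L τ ρ)) x - latticeKernel (hM n 2 τ) x := by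
  have hκ0 : 0 ≤ kappaB (d + 1) 2 := (kappaB_pos (d + 1) 2).le
  have hint : ∀ ρ ∈ (Finset.univ : Finset (Fin (d + 1) → Fin L)), IntegrableOn (integrand (hM (n * L) 2 (Tsub n L τ ρ)) x) (BZ (d + 1)) :=
    fun ρ _ => (stripRegular_hM (n * L) 2 (Tsub n L τ ρ)).integrableOn hκ0 x
  have h1 := B4Green244.latticeKernel_sum_mul Finset.univ (fun _ => (1 : ℂ)) (fun ρ => hM (n * L) 2 (Tsub n L τ ρ)) x hint
  simp only [one_mul] at h1
  have hintS : IntegrableOn (integrand (fun P => ∑ ρ : Fin (d + 1) → Fin L, hM (n * L) 2 (Tsub n L τ ρ) P) x) (BZ (d + 1)) := by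
    have : integrand (fun P => ∑ ρ : Fin (d + 1) → Fin L, hM (n * L) 2 (Tsub n L τ ρ) P) x
        = fun p => ∑ ρ : Fin (d + 1) → Fin L, integrand (hM (n * L) 2 (Tsub n L τ ρ)) x p := by
      funext p; unfold integrand; rw [Finset.sum_mul]
    rw [this]
    exact MeasureTheory.integrable_finsetSum _ fun ρ _ => hint ρ (Finset.mem_univ ρ)
  unfold Dsym
  rw [latticeKernel_sub x hintS ((stripRegular_hM n 2 τ).integrableOn hκ0 x), h1]

/-- [our proof] **THE TWO-LEVEL KERNEL RATE OF THE BLOCK-SUM RESPONSE** (order 2): for every `n, L ≥ 1`, cell `τ` and block separation `x`,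
`‖Σ_ρ latticeKernel (hM (n·L) 2 (Tsub τ ρ)) x − latticeKernel (hM n 2 τ) x‖ ≤ ((n:ℝ)^{d+1})⁻¹·(Cb (d+1) L·HF n (d+1)∕n²)·e^{−kappaB (d+1) 2·|x|_∞}`. -/
theorem two_level_kernel_rate (n L : ℕ) [NeZero n] [NeZero L] (τ : Fin (d + 1) → Fin n) (x : Fin (d + 1) → ℤ) :
    ‖∑ ρ : Fin (d + 1) → Fin L, latticeKernel (hM (n * L) 2 (Tsub n L τ ρ)) x - latticeKernel (hM n 2 τ) x‖
      ≤ ((n : ℝ) ^ (d + 1))⁻¹ * (Cb (d + 1) L * HF n (d + 1) / (n : ℝ) ^ 2) * Real.exp (-(kappaB (d + 1) 2 * supNorm x)) := by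
  rw [← latticeKernel_Dsym]
  exact latticeKernel_decay (stripRegular_Dsym n L τ) (kappaB_pos (d + 1) 2).le x

/-! ## §2 The one-step law of `Hb` -/

/-- [our proof] **THE ONE-STEP LAW OF d1-p3's BLOCK-SUM RESPONSE KERNEL**: for every `n, L ≥ 1`, block `X`, level-`n` cell `τ`, source block `y`,
`|Σ_ρ Hb_{nL}((nL)•X + Tsub τ ρ, y) − Hb_n(n•X + τ, y)| ≤ ((n:ℝ)^{d+1})⁻¹·(Cb (d+1) L·HF n (d+1)∕n²)·e^{−kappaB (d+1) 2·|X − y|_∞}`. -/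
theorem Hb_two_level_rate (n L : ℕ) [NeZero n] [NeZero L] [NeZero (n * L)] (X y : Fin (d + 1) → ℤ) (τ : Fin (d + 1) → Fin n) :
    |∑ ρ : Fin (d + 1) → Fin L, Hb (N := n * L) (finePt (n * L) X (Tsub n L τ ρ)) y - Hb (N := n) (finePt n X τ) y|
      ≤ ((n : ℝ) ^ (d + 1))⁻¹ * (Cb (d + 1) L * HF n (d + 1) / (n : ℝ) ^ 2) * Real.exp (-(kappaB (d + 1) 2 * supNorm (X - y))) := by
  have e1 : ∀ ρ : Fin (d + 1) → Fin L, Hb (N := n * L) (finePt (n * L) X (Tsub n L τ ρ)) y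
      = (latticeKernel (hM (n * L) 2 (Tsub n L τ ρ)) (X - y)).re := fun ρ => by
    rw [Hb_eq_re_KH]; unfold KH; rw [coarse_finePt, offset_finePt]
  have e2 : Hb (N := n) (finePt n X τ) y = (latticeKernel (hM n 2 τ) (X - y)).re := by
    rw [Hb_eq_re_KH]; unfold KH; rw [coarse_finePt, offset_finePt]
  simp_rw [e1, e2]
  rw [← Complex.re_sum, ← Complex.sub_re]
  exact (Complex.abs_re_le_norm _).trans (two_level_kernel_rate n L τ (X - y))

/-- [our proof] **THE BLOCK-MEAN FORM WITH THE LOGARITHM DISPLAYED**: for every `n, L ≥ 1`,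
`|(n^{d+1})·(Σ_ρ Hb_{nL}(…) − Hb_n(…))| ≤ Cb (d+1) L·(48(1+log n))^{d+1}∕n²·e^{−kappaB (d+1) 2·|X − y|_∞}` — the CONVERGENCE half of Q-FP-13-2 for the
response in one-step form (rate `(log n)^{d+1}∕n²`, every power displayed). -/
theorem Hb_two_level_rate_scaled (n L : ℕ) [NeZero n] [NeZero L] [NeZero (n * L)] (X y : Fin (d + 1) → ℤ) (τ : Fin (d + 1) → Fin n) :
    |(n : ℝ) ^ (d + 1) * (∑ ρ : Fin (d + 1) → Fin L, Hb (N := n * L) (finePt (n * L) X (Tsub n L τ ρ)) y - Hb (N := n) (finePt n X τ) y)|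
      ≤ Cb (d + 1) L * (48 * (1 + Real.log n)) ^ (d + 1) / (n : ℝ) ^ 2 * Real.exp (-(kappaB (d + 1) 2 * supNorm (X - y))) := by
  have hn : (0 : ℝ) < (n : ℝ) ^ (d + 1) := by
    have : (0 : ℝ) < n := by exact_mod_cast Nat.pos_of_ne_zero (NeZero.ne n)
    positivity
  have hCb := Cb_nonneg (d + 1) L
  have hHF := HF_le_log n (d + 1)
  have h := Hb_two_level_rate n L X y τ
  rw [abs_mul, abs_of_pos hn]
  calc (n : ℝ) ^ (d + 1) * |∑ ρ : Fin (d + 1) → Fin L, Hb (N := n * L) (finePt (n * L) X (Tsub n L τ ρ)) y - Hb (N := n) (finePt n X τ) y|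
      ≤ (n : ℝ) ^ (d + 1) * (((n : ℝ) ^ (d + 1))⁻¹ * (Cb (d + 1) L * HF n (d + 1) / (n : ℝ) ^ 2) * Real.exp (-(kappaB (d + 1) 2 * supNorm (X - y)))) :=
        mul_le_mul_of_nonneg_left h hn.le
    _ = Cb (d + 1) L * HF n (d + 1) / (n : ℝ) ^ 2 * Real.exp (-(kappaB (d + 1) 2 * supNorm (X - y))) := by field_simp
    _ ≤ Cb (d + 1) L * (48 * (1 + Real.log n)) ^ (d + 1) / (n : ℝ) ^ 2 * Real.exp (-(kappaB (d + 1) 2 * supNorm (X - y))) := by gcongr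

/-- [our proof] **THE ONE-STEP LAW OF an2's MULTIPLIER KERNEL `Wb` IN THE SOURCE VARIABLE** (through d1-p3's `Wb = −Hbᵀ`,
`BiLaplaceResponseIsMultiplier.Wb_eq_neg_Hb`): for every `n, L ≥ 1`, block `X`, level-`n` cell `τ`, multiplier block `y`,
`|Σ_ρ Wb_{nL}(y, (nL)•X + Tsub τ ρ) − Wb_n(y, n•X + τ)| ≤ ((n:ℝ)^{d+1})⁻¹·(Cb (d+1) L·HF n (d+1)∕n²)·e^{−kappaB (d+1) 2·|X − y|_∞}`. -/
theorem Wb_two_level_rate (n L : ℕ) [NeZero n] [NeZero L] [NeZero (n * L)] (X y : Fin (d + 1) → ℤ) (τ : Fin (d + 1) → Fin n) :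
    |∑ ρ : Fin (d + 1) → Fin L, Wb (N := n * L) y (finePt (n * L) X (Tsub n L τ ρ)) - Wb (N := n) y (finePt n X τ)|
      ≤ ((n : ℝ) ^ (d + 1))⁻¹ * (Cb (d + 1) L * HF n (d + 1) / (n : ℝ) ^ 2) * Real.exp (-(kappaB (d + 1) 2 * supNorm (X - y))) := by
  simp_rw [Wb_eq_neg_Hb]
  rw [Finset.sum_neg_distrib, show ∀ a b : ℝ, -a - -b = -(a - b) from fun a b => by ring, abs_neg]
  exact Hb_two_level_rate n L X y τ

end Summit.QuantumFields.BalabanUV.Beta.FP.ConstrainedBiLaplacianResponseTwoLevelRate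

end
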